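import Summits.HodgeConjecture.CorCM.Census.QuarticInversionResidual

/-!
# The quartic inversion twists, IX: the pair-normal form and the KEY LEMMA

COR-CM (cell `pub-hodgecm2`, stage 2 of the Hodge ladder), count-neutral KERNEL COMBINATORICS by the binder seat b23 (gen 44; claim
QUARTIC-INVERSION, HOME/INBOX.md l.12829).  Part IX of the lane `Census/QuarticInversion*`, on top of parts I–VIII (`…Residual`: how the weights read residual labels), all BY NAME.  One bookkeeping definition with body (`nrm₄`) + theorems;
no `Prop`-valued definition, no `decide` table, no certificate, no named fact, no geometry, no `sorry`.  `Interfaces.lean` (C1), every E term, B01,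
`Transposition/*`, `PortJoin/*` untouched.
HONEST FRAMING: `HC_CM` is NOT proved, here or anywhere in the tree; nothing here is a period, a count of record or a headline.

CONTENT (`|B|` odd and `≥ 3`).
* §3 **The pair-normal form** `nrm₄ r (Θ) = [coord 0 Θ low]·(r Θ − r Θ̄)`: `r − nrm₄ r ∈ pairs₄` (`sub_nrm₄_mem_pairs₄`; conjugation flips the half of
  coordinate `0` since `|B|` is odd), `nrm₄ r` is supported on low-`0` labels, and on residual labels if `r` is.
* §4 **KEY LEMMA** (`eq_zero_of_killed`, `mem_pairs₄_of_killed`): a vector supported on residual labels and killed by every `fnl (wA j η u)` and every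
  `fnl (wC η)` lies in `pairs₄` — its normal form has no atom coefficient (read by the atom functional of the heavy representative) and then no
  constant coefficient (read by the constant functional).  This is the four-coordinate analogue of the dicyclic lane's `eq_zero_of_normal`.
All [folklore].

## References
* [Pohlmann1968] H. Pohlmann, Algebraic cycles on abelian varieties of complex multiplication type, Ann. of Math. 88 (1968), Thm 1.
-/

namespace Summit.HodgeConjecture.CorCM.Census.QuarticInversion

open Finset
open Summit.HodgeConjecture.CorCM.Census.OddSliceFacesModel
open Summit.HodgeConjecture.CorCM.Census.OddSliceFacesSquares (clsTy)
open Summit.HodgeConjecture.CorCM.Census.OddSliceFacesDescent (wt_zero wt_delta delta_ne_zero)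
open Summit.HodgeConjecture.CorCM.Census.EvenSliceFacesDescent (clsTy_add_one)
open Summit.HodgeConjecture.CorCM.Census.DicyclicTwist (Ty₂)

noncomputable section

variable (A : Type) [AddCommGroup A] [Fintype A] [DecidableEq A]

/-! ## §3 The pair-normal form -/

/-- **The pair-normal form**: keep, on labels whose coordinate `0` is low, the coefficient minus the conjugate coefficient. [folklore] -/
def nrm₄ (r : Ty₄ A → ℤ) : Ty₄ A → ℤ := fun Θ => if half A (coord A 0 Θ) = true then r Θ - r (conj₄ A Θ) else 0

omit [AddCommGroup A] [DecidableEq A] in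
/-- For `|B|` odd, exactly one of `Θ, Θ̄` has coordinate `0` low. [folklore] -/
theorem half_coord_zero_conj₄ (hA : Odd (Fintype.card A)) (Θ : Ty₄ A) : half A (coord A 0 (conj₄ A Θ)) = !half A (coord A 0 Θ) := by
  rw [coord_conj₄, half_add_one A hA]

omit [AddCommGroup A] in
/-- **`r − nrm₄ r ∈ pairs₄`** (`|B|` odd): it is the sum of `r(Θ)·(e_Θ + e_Θ̄)` over the labels `Θ` whose coordinate `0` is up. [folklore] -/
theorem sub_nrm₄_mem_pairs₄ (hA : Odd (Fintype.card A)) (r : Ty₄ A → ℤ) : r - nrm₄ A r ∈ pairs₄ A := by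
  classical
  set U : Finset (Ty₄ A) := univ.filter (fun Θ : Ty₄ A => half A (coord A 0 Θ) = false) with hU
  have hmemU : ∀ Θ, Θ ∈ U ↔ half A (coord A 0 Θ) = false := fun Θ => by rw [hU]; simp
  have key : r - nrm₄ A r = ∑ Θ ∈ U, r Θ • pairVec₄ A Θ := by
    funext Φ
    rw [Finset.sum_apply, Pi.sub_apply]
    have hterm : ∀ Θ : Ty₄ A, (r Θ • pairVec₄ A Θ) Φ = r Θ * ((if Φ = Θ then 1 else 0) + if Φ = conj₄ A Θ then 1 else 0) := fun Θ => by
      simp only [Pi.smul_apply, pairVec₄, Pi.add_apply, Pi.single_apply, smul_eq_mul]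
    simp only [hterm]
    unfold nrm₄
    cases hh : half A (coord A 0 Φ)
    · -- `Φ` up: only the term `Θ = Φ` survives
      rw [Finset.sum_eq_single_of_mem Φ ((hmemU Φ).mpr hh)]
      · have hne : Φ ≠ conj₄ A Φ := fun h => by
          have h' := half_coord_zero_conj₄ A hA Φ
          rw [← h, hh] at h'; exact absurd h' (by decide)
        simp [hne]
      · intro Θ hΘ hne
        have h1 : ¬ Φ = Θ := fun h => hne (h ▸ rfl) |>.elim
        have h2 : ¬ Φ = conj₄ A Θ := fun h => by
          have hΘ' := (hmemU Θ).mp hΘ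
          have := half_coord_zero_conj₄ A hA Θ
          rw [← h, hh, hΘ'] at this; exact absurd this (by decide)
        rw [if_neg h1, if_neg h2, add_zero, mul_zero]
    · -- `Φ` low: only the term `Θ = Φ̄` survives
      have hbU : conj₄ A Φ ∈ U := (hmemU _).mpr (by rw [half_coord_zero_conj₄ A hA, hh]; rfl)
      rw [Finset.sum_eq_single_of_mem (conj₄ A Φ) hbU]
      · have hne : ¬ Φ = conj₄ A Φ := fun h => by
          have h' := half_coord_zero_conj₄ A hA Φ
          rw [← h, hh] at h'; exact absurd h' (by decide)
        simp [hne]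
      · intro Θ hΘ hne
        have h1 : ¬ Φ = Θ := fun h => by
          have hΘ' := (hmemU Θ).mp hΘ; rw [← h, hh] at hΘ'; exact absurd hΘ' (by decide)
        have h2 : ¬ Φ = conj₄ A Θ := fun h => hne (by rw [h, conj₄_conj₄])
        rw [if_neg h1, if_neg h2, add_zero, mul_zero]
  rw [key]
  exact Submodule.sum_mem _ fun Θ _ => Submodule.smul_mem _ _ (Submodule.subset_span ⟨Θ, rfl⟩)

omit [AddCommGroup A] [DecidableEq A] in
/-- The normal form is supported on low-`0` labels, at labels where `r` or `r ∘ conj` is nonzero. [folklore] -/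
theorem nrm₄_support {r : Ty₄ A → ℤ} {Θ : Ty₄ A} (h : nrm₄ A r Θ ≠ 0) :
    half A (coord A 0 Θ) = true ∧ (r Θ ≠ 0 ∨ r (conj₄ A Θ) ≠ 0) := by
  unfold nrm₄ at h
  by_cases hh : half A (coord A 0 Θ) = true
  · refine ⟨hh, ?_⟩
    rw [if_pos hh] at h
    by_contra hc; push Not at hc
    rw [hc.1, hc.2, sub_zero] at h; exact h rfl
  · rw [if_neg hh] at h; exact absurd rfl h

omit [DecidableEq A] in
/-- The normal form of a residual vector is residual. [folklore] -/
theorem nrm₄_residual {r : Ty₄ A → ℤ} (hres : ∀ Θ, r Θ ≠ 0 → pot₄ A Θ ≤ 1) {Θ : Ty₄ A} (h : nrm₄ A r Θ ≠ 0) : pot₄ A Θ ≤ 1 := by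
  rcases (nrm₄_support A h).2 with h1 | h1
  · exact hres Θ h1
  · have := hres _ h1; rwa [pot₄_conj₄] at this

/-- Functionals do not see the difference between `r` and its normal form. [folklore] -/
theorem fnl_nrm₄ (hA : Odd (Fintype.card A)) (w : Ty₄ A → ℤ) (r : Ty₄ A → ℤ) : fnl A w (nrm₄ A r) = fnl A w r := by
  have h := fnl_eq_zero_of_mem_pairs₄ A w (sub_nrm₄_mem_pairs₄ A hA r)
  rw [map_sub, sub_eq_zero] at h
  exact h.symm

/-! ## §4 The key lemma -/

omit [AddCommGroup A] in
/-- A pair-odd functional whose weight is carried, among the support, by at most the pair `{Θ, Θ̄}` reads `± v(Θ)`. [folklore] -/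
theorem fnl_eq_single_term {w : Ty₄ A → ℤ} {v : Ty₄ A → ℤ} {Θ : Ty₄ A}
    (hΘ : ∀ Φ, v Φ ≠ 0 → Φ ≠ Θ → w Φ = 0 ∧ w (conj₄ A Φ) = 0) :
    fnl A w v = v Θ * (w Θ - w (conj₄ A Θ)) := by
  show ∑ Φ, v Φ * (w Φ - w (conj₄ A Φ)) = _
  rw [Finset.sum_eq_single Θ]
  · intro Φ _ hne
    by_cases hv : v Φ = 0
    · rw [hv, zero_mul]
    · obtain ⟨h1, h2⟩ := hΘ Φ hv hne
      rw [h1, h2, sub_zero, mul_zero]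
  · intro h; exact absurd (Finset.mem_univ Θ) h

/-- **KEY LEMMA (normal form)**: a vector supported on residual, low-`0` labels and killed by every atom functional and every constant functional
is zero (`|B|` odd, `≥ 3`). [folklore] -/
theorem eq_zero_of_killed (hA : Odd (Fintype.card A)) (h3 : 3 ≤ Fintype.card A) {v : Ty₄ A → ℤ}
    (hres : ∀ Θ, v Θ ≠ 0 → pot₄ A Θ ≤ 1) (hlow : ∀ Θ, v Θ ≠ 0 → half A (coord A 0 Θ) = true)
    (hkA : ∀ j η u, fnl A (wA A j η u) v = 0) (hkC : ∀ η, fnl A (wC A η) v = 0) : v = 0 := by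
  have hconjlow : ∀ Θ, v Θ ≠ 0 → v (conj₄ A Θ) = 0 := fun Θ hΘ => by
    by_contra h
    have h1 := hlow _ h
    rw [half_coord_zero_conj₄ A hA, hlow Θ hΘ] at h1
    exact absurd h1 (by decide)
  -- Step 1: no atom coefficients
  have hatoms : ∀ Θ, pot₄ A Θ = 1 → v Θ = 0 := by
    intro Θ hpot
    by_contra hvΘ
    -- the atom coordinate
    have hex : ∃ j, clsTy A (coord A j Θ) = 1 := by
      by_contra hne; push Not at hne
      have hz : ∀ k, clsTy A (coord A k Θ) = 0 := fun k => by
        have := clsTy_coord_le_one A (le_of_eq hpot) k; have := hne k; omega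
      rw [pot₄_eq_sum, Finset.sum_eq_zero (fun k _ => hz k)] at hpot
      exact zero_ne_one hpot
    obtain ⟨j, hj⟩ := hex
    obtain ⟨u, ha | ha⟩ := exists_of_clsTy_eq_one A hj
    · -- light atom at Θ: read through the conjugate (heavy) label with η = halves of Θ̄
      set η : Fin 4 → Bool := fun i => half A (coord A i (conj₄ A Θ)) with hη
      have hwbar : wA A j η u (conj₄ A Θ) = 1 := by
        rw [wA_eq_one_iff]
        refine ⟨fun i _ => rfl, ?_, ?_⟩
        · rw [coord_conj₄, ha, add_comm, half_one_add_delta A h3]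
        · rw [coord_conj₄, ha, Pi.add_apply, delta_apply, if_pos rfl, Pi.one_apply]; decide
      have hwΘ : wA A j η u Θ = 0 := by
        by_contra h
        have h := (wA_eq_one_iff A j η u Θ).mp (wA_eq_one_of_ne_zero A h)
        rw [ha, half_delta A (by omega)] at h
        exact absurd h.2.1 (by decide)
      have hval := fnl_eq_single_term A (w := wA A j η u) (v := v) (Θ := Θ) (fun Φ hΦ hne => by
        constructor
        · by_contra h
          have := residual_eq_of_wA A (by omega) (hres Φ hΦ) (by rw [pot₄_conj₄]; exact le_of_eq hpot) (wA_eq_one_of_ne_zero A h) hwbar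
          exact absurd (hconjlow Θ hvΘ) (this ▸ hΦ)
        · by_contra h
          have := residual_eq_of_wA A (by omega) (by rw [pot₄_conj₄]; exact hres Φ hΦ) (by rw [pot₄_conj₄]; exact le_of_eq hpot)
            (wA_eq_one_of_ne_zero A h) hwbar
          exact hne (by simpa using congrArg (conj₄ A) this))
      have h0 : v Θ * (wA A j η u Θ - wA A j η u (conj₄ A Θ)) = 0 := by rw [← hval]; exact hkA j η u
      rw [hwΘ, hwbar] at h0
      simp at h0
      exact hvΘ h0
    · -- heavy atom at Θ: η = halves of Θ
      set η : Fin 4 → Bool := fun i => half A (coord A i Θ) with hη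
      have hwΘ : wA A j η u Θ = 1 := by
        rw [wA_eq_one_iff]
        refine ⟨fun i _ => rfl, ?_, ?_⟩
        · rw [ha, half_one_add_delta A h3]
        · rw [ha, Pi.add_apply, delta_apply, if_pos rfl, Pi.one_apply]; decide
      have hwbar : wA A j η u (conj₄ A Θ) = 0 := by
        by_contra h
        have h := (wA_eq_one_iff A j η u _).mp (wA_eq_one_of_ne_zero A h)
        have e : coord A j (conj₄ A Θ) = δ A u := by rw [coord_conj₄, ha, add_comm (1 : Ty A), add_one_add_one]
        rw [e, half_delta A (by omega)] at h
        exact absurd h.2.1 (by decide)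
      have hval := fnl_eq_single_term A (w := wA A j η u) (v := v) (Θ := Θ) (fun Φ hΦ hne => by
        constructor
        · by_contra h
          exact hne (residual_eq_of_wA A (by omega) (hres Φ hΦ) (le_of_eq hpot) (wA_eq_one_of_ne_zero A h) hwΘ)
        · by_contra h
          have := residual_eq_of_wA A (by omega) (by rw [pot₄_conj₄]; exact hres Φ hΦ) (le_of_eq hpot) (wA_eq_one_of_ne_zero A h) hwΘ
          have hΦ' : Φ = conj₄ A Θ := by rw [← this, conj₄_conj₄]
          exact absurd (hconjlow Θ hvΘ) (hΦ' ▸ hΦ))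
      have h0 : v Θ * (wA A j η u Θ - wA A j η u (conj₄ A Θ)) = 0 := by rw [← hval]; exact hkA j η u
      rw [hwΘ, hwbar] at h0
      simp at h0
      exact hvΘ h0
  -- Step 2: no constant coefficients
  funext Θ
  rw [Pi.zero_apply]
  by_contra hvΘ
  have hpot : pot₄ A Θ = 0 := by
    have h1 := hres Θ hvΘ
    rcases Nat.lt_or_ge (pot₄ A Θ) 1 with h0 | h1'
    · omega
    · exact absurd (hatoms Θ (le_antisymm h1 h1')) hvΘ
  set η : Fin 4 → Bool := fun i => half A (coord A i Θ) with hη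
  have hwΘ : wC A η Θ = 1 := (wC_eq_one_iff A η Θ).mpr fun i => rfl
  have hwbar : wC A η (conj₄ A Θ) = 0 := by
    by_contra h
    have h := (wC_eq_one_iff A η _).mp (wC_eq_one_of_ne_zero A h)
    have h0 := h 0
    rw [half_coord_zero_conj₄ A hA] at h0
    exact Bool.not_ne_self _ h0
  have hval := fnl_eq_single_term A (w := wC A η) (v := v) (Θ := Θ) (fun Φ hΦ hne => by
    have hΦ0 : pot₄ A Φ = 0 := by
      have h1 := hres Φ hΦ
      rcases Nat.lt_or_ge (pot₄ A Φ) 1 with h0 | h1'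
      · omega
      · exact absurd (hatoms Φ (le_antisymm h1 h1')) hΦ
    constructor
    · by_contra h
      exact hne (constant_eq_of_wC A (by omega) hΦ0 hpot (wC_eq_one_of_ne_zero A h) hwΘ)
    · by_contra h
      have := constant_eq_of_wC A (by omega) (by rw [pot₄_conj₄]; exact hΦ0) hpot (wC_eq_one_of_ne_zero A h) hwΘ
      have hΦ' : Φ = conj₄ A Θ := by rw [← this, conj₄_conj₄]
      exact absurd (hconjlow Θ hvΘ) (hΦ' ▸ hΦ))
  have h0 : v Θ * (wC A η Θ - wC A η (conj₄ A Θ)) = 0 := by rw [← hval]; exact hkC η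
  rw [hwΘ, hwbar] at h0
  simp at h0
  exact hvΘ h0

/-- **KEY LEMMA**: a vector supported on residual labels and killed by every atom functional and every constant functional lies in `pairs₄`
(`|B|` odd, `≥ 3`). [folklore] -/
theorem mem_pairs₄_of_killed (hA : Odd (Fintype.card A)) (h3 : 3 ≤ Fintype.card A) {r : Ty₄ A → ℤ}
    (hres : ∀ Θ, r Θ ≠ 0 → pot₄ A Θ ≤ 1) (hkA : ∀ j η u, fnl A (wA A j η u) r = 0) (hkC : ∀ η, fnl A (wC A η) r = 0) :
    r ∈ pairs₄ A := by
  have h0 : nrm₄ A r = 0 :=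
    eq_zero_of_killed A hA h3 (fun Θ h => nrm₄_residual A hres h) (fun Θ h => (nrm₄_support A h).1)
      (fun j η u => by rw [fnl_nrm₄ A hA, hkA]) (fun η => by rw [fnl_nrm₄ A hA, hkC])
  have h := sub_nrm₄_mem_pairs₄ A hA r
  rwa [h0, sub_zero] at h

end

end Summit.HodgeConjecture.CorCM.Census.QuarticInversion
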